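import Literature.AlgebraicGeometry.Pohlmann1968.CMFamilyRankPartition
import Summits.HodgeConjecture.CorCM.TwoSimpleCMSurfacesHodge
import HarnessLib

/-!
# Products of ANY NUMBER of simple CM abelian surfaces: `B• = D•` on all power products iff no three of the quartic CM
# fields share their Galois closure — and then the Hodge conjecture holds

COR-CM (cell `pub-hodgecm2`, binder seat `p2` gen 20), count-neutral; NEW as stated, hence under `Summits/`.  HONEST
FRAMING: an unconditional theorem on products of CM abelian SURFACES; not a step of the summit chain (`HC_CM` is not
used and not advanced).

THE CLASSIFICATION.  Let `S_i` (`i ∈ I`, finite) be pairwise non-isogenous SIMPLE complex abelian surfaces of CM type,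
realisations of CM types `Φ_i` of quartic CM fields `K_i`, and let `L_i = K_i^{gal} ≤ ℂ` be the Galois closures (cyclic
of degree `4`, or dihedral of degree `8`).  Then

* `isNondegenerateFamily_iff_simpleSurfaces` — **the family `(Φ_i)_i` is nondegenerate (equivalently: every product
  `∏_i S_i^{a_i}` has `B• = D•`, no power product carries an exceptional Hodge class, `Hg(∏ S_i) = ∏ Hg(S_i)`) IF AND
  ONLY IF no three pairwise distinct indices have `L_i = L_j = L_k`**;
* `hodgeConjectureFor_prod_simpleSurfaces_of_closures` — hence **the Hodge conjecture, with all Hodge classes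
  polynomials in divisor classes, on EVERY `⨁_{j<N} S_{π j}` as soon as no three of the fields share their closure**;
* `exists_exceptional_prod_simpleSurfaces_of_closures` — and conversely an exceptional Hodge class on some power product
  as soon as three do (the dihedral triple `S × S' × S''` of `CorCM/DihedralReflexTripleCMHodge`, where the exceptional
  classes sit on the triple itself, in codimensions `2, 3, 4`).

At the level of types (`§1`, no realisations, no separation hypothesis): for ANY family of CM types of quartic CM fields,
nondegeneracy forces every Galois-closure class to have at most two slots, and at most ONE slot when the field is Galois
(`IsNondegenerateFamily.card_normalClosure_class_le_two`, `….normalClosure_ne_of_isGalois`).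

PROOF.  Blocks = Galois-closure classes.  Two DIFFERENT closures of quartic CM fields carrying primitive types meet in a
totally real field (seat b23's `conj_apply_eq_of_mem_inf_of_normalClosure_ne`), so by the PAIRWISE-BETWEEN-BLOCKS
criterion (`Pohlmann1968/CMFamilyRankPartition`, this seat) the family is nondegenerate iff every closure class is; a
class of one slot is a primitive quartic type (nondegenerate, Ribet), a class of two is a pair of simple non-isogenous CM
surfaces (nondegenerate: Moonen–Zarhin, the tree's `isNondegenerateFamily_simpleSurfaces` of seat b23), and a class
`J` of `≥ 3` slots (`≥ 2` for a cyclic field) is degenerate by the closure bound `Σ_{j∈J} [K_j:ℚ] ≤ [L:ℚ] ≤ 8` of a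
nondegenerate family (`sum_finrank_le_of_isNondegenerateFamily`, this seat gen 18) — blocks of a nondegenerate family
being nondegenerate for every partition (`IsNondegenerateFamily.fiber`).

LITERATURE.  Moonen–Zarhin 1999 treat `dim ≤ 5` (at most two surfaces).  J. J. Ramón-Marí, *On the Hodge conjecture
for products of certain surfaces*, Collect. Math. 59 (2008), Prop. 2.18, states the Hodge conjecture for ALL products
of abelian surfaces and curves, reducing «by Goursat's Lemma» to the pairwise splitting `Hg(A₁ × A₂) = Hg(A₁) × Hg(A₂)`;
for simple CM surfaces the `Hg(S_i)` are `2`-dimensional TORI, isogenous for the two quartic CM fields of one dihedral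
closure (his Lemma 2.17: `U_F(1) ≃ U_E(1)`), and pairwise splitting does NOT propagate to triples: the dihedral triple has
every pair split and `dim Hg = 4 < 6` (`DihedralReflexTriple.cmFamilyRank_eq_five`).  The present file records exactly
which products of simple CM surfaces the pairwise argument does cover; for the others (three fields in one dihedral
closure) the Hodge conjecture is NOT settled by anything in this tree.  Theorems only; no definition, no named fact.

## References
* [MoonenZarhin1999LowDim] B. Moonen, Yu. Zarhin, *Hodge classes on abelian varieties of low dimension*, Math. Ann. 315
  (1999) 711–733, §3 (3.1), "Hodge groups of simple abelian surfaces of CM-type", Cor. (3.9).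
* [Gordon1999HodgeAVSurvey] B. B. Gordon, *A survey of the Hodge conjecture for abelian varieties*, 7.5–7.7, §9.2, 10.10.
* [Shimura1998] G. Shimura, *Abelian Varieties with Complex Multiplication and Modular Functions*, §8.4 Example (2).
* J. J. Ramón-Marí, *On the Hodge conjecture for products of certain surfaces*, Collect. Math. 59 (2008) 1–26,
  Lemma 2.17, Prop. 2.18 (arXiv:math/0505357) — discussed above, not used.
-/

noncomputable section

open CategoryTheory CategoryTheory.Limits NumberField NumberField.ComplexEmbedding IntermediateField Module

namespace Summit.HodgeConjecture.CorCM

open Literature.NumberTheory.ComplexMultiplication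
open Literature.AlgebraicGeometry.Motives (AbelianVariety CMType)
open Literature.AlgebraicGeometry.HodgeTheory
open Literature.AlgebraicGeometry.ComplexMultiplication (IsCMTypeRealisation isSimple_iff_isPrimitive)
open Literature.AlgebraicGeometry.VanGeemen1994 (hodgeClassSpan)
open Literature.AlgebraicGeometry.Pohlmann1968
open Literature.Barriers.HodgeConjecture (divisorClassesSpan)

namespace SimpleCMSurfaceProducts

/-! ### §1 Type level: a nondegenerate family of quartic CM types has at most two slots per Galois closure -/

section Types

variable {I : Type} {K : I → Type} [∀ i, Field (K i)] [∀ i, NumberField (K i)] [∀ i, IsCMField (K i)] [Fintype I]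
  [Nonempty I]

omit [Fintype I] [Nonempty I] in
/-- The Galois closure in `ℂ` of a quartic CM field has degree at most `8` (`4` if the field is Galois, `8` if not).
[cite: Shimura1998, §8.4 Example (2)] -/
theorem finrank_normalClosure_le_eight (i : I) (h4 : finrank ℚ (K i) = 4) :
    finrank ℚ ↥(normalClosure ℚ (K i) ℂ) ≤ 8 := by
  by_cases hK : IsGalois ℚ (K i)
  · haveI := hK
    rw [finrank_normalClosure_of_normal (K := K i), h4]
    norm_num
  · rw [finrank_normalClosure_complex_eq_eight i h4 hK]

/-- **A closure class of a NONDEGENERATE family of quartic CM types has at most two slots**: the class `J` of `L_{i₀}`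
is a block of the partition by closures, hence a nondegenerate sub-family (`IsNondegenerateFamily.fiber`, no hypothesis
between the blocks), all of whose fields embed into `L_{i₀}` of degree `≤ 8`; the closure bound
`Σ_{j∈J} [K_j:ℚ] ≤ [L_{i₀}:ℚ]` gives `4|J| ≤ 8`. [cite: Gordon1999HodgeAVSurvey, 7.6.1 and 7.7] -/
theorem card_normalClosure_class_le_two {Φ : ∀ i, CMType (K i)} (h4 : ∀ i, finrank ℚ (K i) = 4)
    (hΦ : CMAlgebra.IsNondegenerateFamily Φ) (i₀ : I) :
    Nat.card {j : I // normalClosure ℚ (K j) ℂ = normalClosure ℚ (K i₀) ℂ} ≤ 2 := by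
  classical
  -- the partition of the slots by Galois closure
  let κ : I → Set.range (fun i : I => normalClosure ℚ (K i) ℂ) := fun i => ⟨normalClosure ℚ (K i) ℂ, i, rfl⟩
  have hκ : Function.Surjective κ := by
    rintro ⟨M, i, rfl⟩
    exact ⟨i, rfl⟩
  have hblock := hΦ.fiber κ hκ (κ i₀)
  -- the block of `i₀` is the closure class of `i₀`
  have hiff : ∀ j : I, κ j = κ i₀ ↔ normalClosure ℚ (K j) ℂ = normalClosure ℚ (K i₀) ℂ := fun j => Subtype.ext_iff
  let e : {j : I // κ j = κ i₀} ≃ {j : I // normalClosure ℚ (K j) ℂ = normalClosure ℚ (K i₀) ℂ} :=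
    Equiv.subtypeEquivRight hiff
  haveI : Nonempty {j : I // κ j = κ i₀} := ⟨⟨i₀, rfl⟩⟩
  have hsum := sum_finrank_le_of_isNondegenerateFamily (Φ := fun j : {j : I // κ j = κ i₀} => Φ j.1)
    (normalClosure ℚ (K i₀) ℂ) (fun j s y => ((hiff j.1).1 j.2) ▸ apply_mem_normalClosure j.1 s y) hblock
  have h4sum : ∑ j : {j : I // κ j = κ i₀}, finrank ℚ (K j.1) = 4 * Fintype.card {j : I // κ j = κ i₀} := by
    rw [Finset.sum_congr rfl fun j _ => h4 j.1, Finset.sum_const, Finset.card_univ, smul_eq_mul, mul_comm]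
  rw [h4sum] at hsum
  have h8 := finrank_normalClosure_le_eight i₀ (h4 i₀)
  rw [Nat.card_eq_fintype_card, ← Fintype.card_congr e]
  omega

/-- **Three pairwise distinct slots of a nondegenerate family of quartic CM types never share their Galois closure.**
[cite: Gordon1999HodgeAVSurvey, 7.6.1 and 7.7] -/
theorem normalClosure_ne_of_isNondegenerateFamily {Φ : ∀ i, CMType (K i)} (h4 : ∀ i, finrank ℚ (K i) = 4)
    (hΦ : CMAlgebra.IsNondegenerateFamily Φ) {i j k : I} (hij : i ≠ j) (hjk : j ≠ k) (hik : i ≠ k)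
    (hLij : normalClosure ℚ (K i) ℂ = normalClosure ℚ (K j) ℂ) :
    normalClosure ℚ (K j) ℂ ≠ normalClosure ℚ (K k) ℂ := by
  classical
  intro hLjk
  have h2 := card_normalClosure_class_le_two h4 hΦ k
  rw [Nat.card_eq_fintype_card] at h2
  let a : {l : I // normalClosure ℚ (K l) ℂ = normalClosure ℚ (K k) ℂ} := ⟨i, hLij.trans hLjk⟩
  let b : {l : I // normalClosure ℚ (K l) ℂ = normalClosure ℚ (K k) ℂ} := ⟨j, hLjk⟩
  let d : {l : I // normalClosure ℚ (K l) ℂ = normalClosure ℚ (K k) ℂ} := ⟨k, rfl⟩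
  have h3 : 2 < Fintype.card {l : I // normalClosure ℚ (K l) ℂ = normalClosure ℚ (K k) ℂ} :=
    Fintype.two_lt_card_iff.2 ⟨a, b, d, fun h => hij (congrArg Subtype.val h),
      fun h => hik (congrArg Subtype.val h), fun h => hjk (congrArg Subtype.val h)⟩
  omega

/-- **A Galois (cyclic) quartic slot of a nondegenerate family shares its closure with NO other slot**: its closure is the
field itself, of degree `4`, and `4|J| ≤ 4`. [cite: Gordon1999HodgeAVSurvey, 7.6.1 and 7.7] -/
theorem normalClosure_ne_of_isGalois {Φ : ∀ i, CMType (K i)} (h4 : ∀ i, finrank ℚ (K i) = 4)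
    (hΦ : CMAlgebra.IsNondegenerateFamily Φ) {i j : I} [IsGalois ℚ (K i)] (hij : i ≠ j) :
    normalClosure ℚ (K j) ℂ ≠ normalClosure ℚ (K i) ℂ := by
  classical
  intro hL
  let κ : I → Set.range (fun i : I => normalClosure ℚ (K i) ℂ) := fun i => ⟨normalClosure ℚ (K i) ℂ, i, rfl⟩
  have hκ : Function.Surjective κ := by
    rintro ⟨M, i, rfl⟩
    exact ⟨i, rfl⟩
  have hblock := hΦ.fiber κ hκ (κ i)
  have hiff : ∀ l : I, κ l = κ i ↔ normalClosure ℚ (K l) ℂ = normalClosure ℚ (K i) ℂ := fun l => Subtype.ext_iff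
  haveI : Nonempty {l : I // κ l = κ i} := ⟨⟨i, rfl⟩⟩
  have hsum := sum_finrank_le_of_isNondegenerateFamily (Φ := fun l : {l : I // κ l = κ i} => Φ l.1)
    (normalClosure ℚ (K i) ℂ) (fun l s y => ((hiff l.1).1 l.2) ▸ apply_mem_normalClosure l.1 s y) hblock
  have h4sum : ∑ l : {l : I // κ l = κ i}, finrank ℚ (K l.1) = 4 * Fintype.card {l : I // κ l = κ i} := by
    rw [Finset.sum_congr rfl fun l _ => h4 l.1, Finset.sum_const, Finset.card_univ, smul_eq_mul, mul_comm]
  rw [h4sum, finrank_normalClosure_of_normal (K := K i), h4 i] at hsum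
  have h2 : 1 < Fintype.card {l : I // κ l = κ i} :=
    Fintype.one_lt_card_iff.2 ⟨⟨i, rfl⟩, ⟨j, (hiff j).2 hL⟩, fun h => hij (congrArg Subtype.val h)⟩
  omega

end Types

/-! ### §2 Simple CM abelian surfaces: the classification -/

section Geometry

variable {I : Type} {K : I → Type} [∀ i, Field (K i)] [∀ i, NumberField (K i)] [∀ i, IsCMField (K i)] [Fintype I]
  [Nonempty I] {Φ : ∀ i, CMType (K i)}
variable {A : I → AbelianVariety ℂ} {ι : ∀ i, 𝓞 (K i) →+* End (A i)}
  {θ : ∀ i, K i →+* Module.End ℂ (complexBetti (A i).X 1)}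

omit [Fintype I] [Nonempty I] in
/-- The CM field of a simple CM abelian surface is not biquadratic (its type is primitive).
[cite: Shimura1998, §8.4 Example (2)(A)] -/
private theorem not_biquadratic (h4 : ∀ i, finrank ℚ (K i) = 4)
    (hA : ∀ i, IsCMTypeRealisation (Φ i) (A i) (ι i) (θ i)) (hS : ∀ i, (A i).IsSimple) (i : I) :
    ¬ (IsGalois ℚ (K i) ∧ ¬ IsCyclic (K i ≃ₐ[ℚ] K i)) :=
  not_biquadratic_of_isPrimitive i (h4 i)
    ((isSimple_iff_isPrimitive (hA i) (Classical.arbitrary (K i →+* ℂ))).1 (hS i))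

/-- **Pairwise non-isogenous simple CM abelian surfaces, no three CM fields with the same Galois closure: the family
of their CM types is NONDEGENERATE** (`Hg(∏_i S_i) = ∏_i Hg(S_i)`, rank `2|I| + 1`).  Blocks = closure classes (pairwise
totally real intersections), each block a single primitive quartic type or a pair of simple non-isogenous CM surfaces.
[cite: MoonenZarhin1999LowDim, §3 (3.1) and "Hodge groups of simple abelian surfaces of CM-type"]
[cite: Gordon1999HodgeAVSurvey, 7.5] -/
theorem isNondegenerateFamily_simpleSurfaces_of_closures (h4 : ∀ i, finrank ℚ (K i) = 4)
    (hA : ∀ i, IsCMTypeRealisation (Φ i) (A i) (ι i) (θ i)) (hS : ∀ i, (A i).IsSimple)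
    (hniso : ∀ i j, i ≠ j → ¬ AbelianVariety.IsIsogenous (A i) (A j))
    (h3 : ∀ i j k : I, i ≠ j → j ≠ k → i ≠ k → normalClosure ℚ (K i) ℂ = normalClosure ℚ (K j) ℂ →
      normalClosure ℚ (K j) ℂ ≠ normalClosure ℚ (K k) ℂ) :
    CMAlgebra.IsNondegenerateFamily Φ := by
  classical
  -- the partition of the slots by Galois closure
  let κ : I → Set.range (fun i : I => normalClosure ℚ (K i) ℂ) := fun i => ⟨normalClosure ℚ (K i) ℂ, i, rfl⟩
  have hκ : Function.Surjective κ := by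
    rintro ⟨M, i, rfl⟩
    exact ⟨i, rfl⟩
  have hiff : ∀ j i : I, κ j = κ i ↔ normalClosure ℚ (K j) ℂ = normalClosure ℚ (K i) ℂ := fun j i => Subtype.ext_iff
  -- distinct closure classes meet in totally real fields
  have hreal : ∀ c c', c ≠ c' → ∀ x : ℂ, x ∈ (⨆ j : {j : I // κ j = c}, normalClosure ℚ (K j.1) ℂ) →
      x ∈ (⨆ j : {j : I // κ j = c'}, normalClosure ℚ (K j.1) ℂ) → starRingEnd ℂ x = x := by
    intro c c' hcc' x hx hx'
    obtain ⟨i, rfl⟩ := hκ c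
    obtain ⟨i', rfl⟩ := hκ c'
    have hne : normalClosure ℚ (K i) ℂ ≠ normalClosure ℚ (K i') ℂ := fun h => hcc' (Subtype.ext h)
    have hxi : x ∈ normalClosure ℚ (K i) ℂ :=
      (iSup_le fun j : {j : I // κ j = κ i} => le_of_eq ((hiff j.1 i).1 j.2)) hx
    have hxi' : x ∈ normalClosure ℚ (K i') ℂ :=
      (iSup_le fun j : {j : I // κ j = κ i'} => le_of_eq ((hiff j.1 i').1 j.2)) hx'
    exact conj_apply_eq_of_mem_inf_of_normalClosure_ne (h4 i) (h4 i') (not_biquadratic h4 hA hS i)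
      (not_biquadratic h4 hA hS i') hne hxi hxi'
  refine (CMAlgebra.isNondegenerateFamily_iff_forall_fiber_of_conj_apply_eq Φ κ hκ hreal).2 fun c => ?_
  -- a closure class has one or two slots
  obtain ⟨i₀, rfl⟩ := hκ c
  haveI : Nonempty {j : I // κ j = κ i₀} := ⟨⟨i₀, rfl⟩⟩
  have hle2 : Fintype.card {j : I // κ j = κ i₀} ≤ 2 := by
    by_contra hlt
    obtain ⟨a, b, d, hab, had, hbd⟩ := Fintype.two_lt_card_iff.1 (not_le.1 hlt)
    exact h3 a.1 b.1 d.1 (fun h => hab (Subtype.ext h)) (fun h => hbd (Subtype.ext h))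
      (fun h => had (Subtype.ext h)) (((hiff a.1 i₀).1 a.2).trans ((hiff b.1 i₀).1 b.2).symm)
      (((hiff b.1 i₀).1 b.2).trans ((hiff d.1 i₀).1 d.2).symm)
  rcases Nat.lt_or_ge (Fintype.card {j : I // κ j = κ i₀}) 2 with hlt | hge
  · -- one slot: a primitive quartic type
    have h1 : Fintype.card {j : I // κ j = κ i₀} = 1 :=
      le_antisymm (by omega) (Fintype.card_pos_iff.2 inferInstance)
    obtain ⟨x, hx⟩ := Fintype.card_eq_one_iff.1 h1
    letI : Unique {j : I // κ j = κ i₀} := ⟨⟨x⟩, hx⟩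
    exact (CMAlgebra.isNondegenerateFamily_iff_isNondegenerate _).2
      (isNondegenerate_of_quartic_not_biquadratic _ (h4 _) (not_biquadratic h4 hA hS _) _)
  · -- two slots: a pair of simple non-isogenous CM surfaces
    have h2 : (Finset.univ : Finset {j : I // κ j = κ i₀}).card = 2 := by
      rw [Finset.card_univ]; omega
    obtain ⟨x, y, hxy, hxy'⟩ := Finset.card_eq_two.1 h2
    have hI : ∀ j : {j : I // κ j = κ i₀}, j = x ∨ j = y := fun j => by
      simpa [hxy'] using Finset.mem_univ j
    exact isNondegenerateFamily_simpleSurfaces hxy hI (fun j => h4 j.1) (fun j => hA j.1) (fun j => hS j.1)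
      fun j j' hne => hniso j.1 j'.1 fun h => hne (Subtype.ext h)

/-- **THE CLASSIFICATION.**  For pairwise non-isogenous simple CM abelian surfaces `S_i` (realisations of CM types
`Φ_i` of quartic CM fields `K_i`), the family `(Φ_i)_i` is nondegenerate — every power product `∏ S_i^{a_i}` has
`B• = D•`, `Hg(∏_i S_i) = ∏_i Hg(S_i)` — IF AND ONLY IF no three pairwise distinct indices have the same Galois closure
`L_i = L_j = L_k`. [cite: MoonenZarhin1999LowDim, §3 (3.1), (3.9)] [cite: Gordon1999HodgeAVSurvey, 7.5–7.7] -/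
theorem isNondegenerateFamily_iff_simpleSurfaces (h4 : ∀ i, finrank ℚ (K i) = 4)
    (hA : ∀ i, IsCMTypeRealisation (Φ i) (A i) (ι i) (θ i)) (hS : ∀ i, (A i).IsSimple)
    (hniso : ∀ i j, i ≠ j → ¬ AbelianVariety.IsIsogenous (A i) (A j)) :
    CMAlgebra.IsNondegenerateFamily Φ ↔
      ∀ i j k : I, i ≠ j → j ≠ k → i ≠ k → normalClosure ℚ (K i) ℂ = normalClosure ℚ (K j) ℂ →
        normalClosure ℚ (K j) ℂ ≠ normalClosure ℚ (K k) ℂ :=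
  ⟨fun hΦ _ _ _ hij hjk hik => normalClosure_ne_of_isNondegenerateFamily h4 hΦ hij hjk hik,
    isNondegenerateFamily_simpleSurfaces_of_closures h4 hA hS hniso⟩

/-- **The Hodge conjecture for every product `∏_j S_{π j}` of pairwise non-isogenous simple CM abelian surfaces no three
of whose CM fields share their Galois closure** — with `Bᵐ ⊗ ℂ = Dᵐ ⊗ ℂ` in every degree (all Hodge classes are
polynomials in divisor classes), UNCONDITIONALLY and for any number of factors and multiplicities.
[cite: MoonenZarhin1999LowDim, §3 (3.1) and Cor. (3.9)] [cite: Gordon1999HodgeAVSurvey, 7.5 and 10.10] -/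
theorem hodgeConjectureFor_prod_simpleSurfaces_of_closures (h4 : ∀ i, finrank ℚ (K i) = 4)
    (hA : ∀ i, IsCMTypeRealisation (Φ i) (A i) (ι i) (θ i)) (hS : ∀ i, (A i).IsSimple)
    (hniso : ∀ i j, i ≠ j → ¬ AbelianVariety.IsIsogenous (A i) (A j))
    (h3 : ∀ i j k : I, i ≠ j → j ≠ k → i ≠ k → normalClosure ℚ (K i) ℂ = normalClosure ℚ (K j) ℂ →
      normalClosure ℚ (K j) ℂ ≠ normalClosure ℚ (K k) ℂ) {N : ℕ} (π : Fin N → I) :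
    HodgeConjectureFor (⨁ fun j : Fin N => A (π j)).dim (⨁ fun j : Fin N => A (π j)).X ∧
      ∀ m : ℕ, hodgeClassSpan (⨁ fun j : Fin N => A (π j)).dim (⨁ fun j : Fin N => A (π j)).X m =
        divisorClassesSpan (⨁ fun j : Fin N => A (π j)).X (⨁ fun j : Fin N => A (π j)).dim m :=
  have hnd := isNondegenerateFamily_simpleSurfaces_of_closures h4 hA hS hniso h3
  ⟨hnd.hodgeConjectureFor_prod hA π, fun m => hnd.hodgeClassSpan_prod_eq_divisorClassesSpan hA π m⟩

/-- No product `∏_j S_{π j}` of pairwise non-isogenous simple CM abelian surfaces, no three CM fields sharing their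
Galois closure, carries an exceptional Hodge class. [cite: MoonenZarhin1999LowDim, §3 (3.1)] [cite: Gordon1999HodgeAVSurvey, 7.5] -/
theorem not_exists_exceptional_prod_simpleSurfaces_of_closures (h4 : ∀ i, finrank ℚ (K i) = 4)
    (hA : ∀ i, IsCMTypeRealisation (Φ i) (A i) (ι i) (θ i)) (hS : ∀ i, (A i).IsSimple)
    (hniso : ∀ i j, i ≠ j → ¬ AbelianVariety.IsIsogenous (A i) (A j))
    (h3 : ∀ i j k : I, i ≠ j → j ≠ k → i ≠ k → normalClosure ℚ (K i) ℂ = normalClosure ℚ (K j) ℂ →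
      normalClosure ℚ (K j) ℂ ≠ normalClosure ℚ (K k) ℂ) {N : ℕ} (π : Fin N → I) (m : ℕ) :
    ¬ ∃ c : complexBetti (⨁ fun j : Fin N => A (π j)).X (2 * m), IsRationalClass c ∧
        IsOfHodgeType (⨁ fun j : Fin N => A (π j)).dim (⨁ fun j : Fin N => A (π j)).X (2 * m) m m c ∧
        c ∉ divisorClassesSpan (⨁ fun j : Fin N => A (π j)).X (⨁ fun j : Fin N => A (π j)).dim m :=
  (isNondegenerateFamily_simpleSurfaces_of_closures h4 hA hS hniso h3).not_exists_exceptional_prod hA π m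

/-- **Conversely: three pairwise non-isogenous simple CM abelian surfaces whose CM fields share their Galois closure
force an exceptional Hodge class** on some product `∏_j S_{π j}` of the family (in fact on the triple itself, in
codimension `2`: `DihedralReflexTriple.exists_exceptional_two_biproduct_of_isSimple`).
[cite: Gordon1999HodgeAVSurvey, 7.5 and §9.2] -/
theorem exists_exceptional_prod_simpleSurfaces_of_closures (h4 : ∀ i, finrank ℚ (K i) = 4)
    (hA : ∀ i, IsCMTypeRealisation (Φ i) (A i) (ι i) (θ i)) (hS : ∀ i, (A i).IsSimple)
    (hniso : ∀ i j, i ≠ j → ¬ AbelianVariety.IsIsogenous (A i) (A j)) {i j k : I} (hij : i ≠ j) (hjk : j ≠ k)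
    (hik : i ≠ k) (hLij : normalClosure ℚ (K i) ℂ = normalClosure ℚ (K j) ℂ)
    (hLjk : normalClosure ℚ (K j) ℂ = normalClosure ℚ (K k) ℂ) :
    ∃ (N : ℕ) (π : Fin N → I) (m : ℕ) (c : complexBetti (⨁ fun l : Fin N => A (π l)).X (2 * m)),
      IsRationalClass c ∧
      IsOfHodgeType (⨁ fun l : Fin N => A (π l)).dim (⨁ fun l : Fin N => A (π l)).X (2 * m) m m c ∧
      c ∉ divisorClassesSpan (⨁ fun l : Fin N => A (π l)).X (⨁ fun l : Fin N => A (π l)).dim m :=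
  CMAlgebra.exists_exceptional_prod_of_not_isNondegenerateFamily
    (CMAlgebra.isSeparatingFamily_of_isSimple_of_pairwise_not_isIsogenous hA hS hniso)
    (fun hΦ => normalClosure_ne_of_isNondegenerateFamily h4 hΦ hij hjk hik hLij hLjk) hA

/-- **Dichotomy on the variety**: for pairwise non-isogenous simple CM abelian surfaces, EITHER no three fields share
their closure and every `∏_j S_{π j}` satisfies the Hodge conjecture with `B• = D•`, OR some product carries an
exceptional Hodge class. [cite: MoonenZarhin1999LowDim, §3 (3.1), (3.9)] [cite: Gordon1999HodgeAVSurvey, 7.5] -/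
theorem hodgeConjectureFor_prod_or_exists_exceptional_simpleSurfaces
    (hA : ∀ i, IsCMTypeRealisation (Φ i) (A i) (ι i) (θ i)) (hS : ∀ i, (A i).IsSimple)
    (hniso : ∀ i j, i ≠ j → ¬ AbelianVariety.IsIsogenous (A i) (A j)) :
    (∀ {N : ℕ} (π : Fin N → I),
      HodgeConjectureFor (⨁ fun j : Fin N => A (π j)).dim (⨁ fun j : Fin N => A (π j)).X ∧
      ∀ m : ℕ, hodgeClassSpan (⨁ fun j : Fin N => A (π j)).dim (⨁ fun j : Fin N => A (π j)).X m =
        divisorClassesSpan (⨁ fun j : Fin N => A (π j)).X (⨁ fun j : Fin N => A (π j)).dim m) ∨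
    ∃ (N : ℕ) (π : Fin N → I) (m : ℕ) (c : complexBetti (⨁ fun l : Fin N => A (π l)).X (2 * m)),
      IsRationalClass c ∧
      IsOfHodgeType (⨁ fun l : Fin N => A (π l)).dim (⨁ fun l : Fin N => A (π l)).X (2 * m) m m c ∧
      c ∉ divisorClassesSpan (⨁ fun l : Fin N => A (π l)).X (⨁ fun l : Fin N => A (π l)).dim m := by
  by_cases hΦ : CMAlgebra.IsNondegenerateFamily Φ
  · exact Or.inl fun π => ⟨hΦ.hodgeConjectureFor_prod hA π, fun m => hΦ.hodgeClassSpan_prod_eq_divisorClassesSpan hA π m⟩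
  · exact Or.inr (CMAlgebra.exists_exceptional_prod_of_not_isNondegenerateFamily
      (CMAlgebra.isSeparatingFamily_of_isSimple_of_pairwise_not_isIsogenous hA hS hniso) hΦ hA)

end Geometry

end SimpleCMSurfaceProducts

end Summit.HodgeConjecture.CorCM

end
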